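import Summits.QuantumFields.BalabanUV.Beta.RemainderExplicitHistoryDiagonalBoundedMemoryRate

/-!
# RemainderExplicitHistoryDiagonalBoundedMemoryProduct — ROAD P3, ORDER-0 PROFILE FAMILY: THE BOUNDED-MEMORY RATE IS SUPER-EXPONENTIAL — the
# third file's contraction `d_j ≤ M₁(G₃∕2)·max_{[j−A,j)} d` is applied with a cube bound PER MEMORY BLOCK (the couplings of the `k`-th block of a
# pinned run sit `A` scales further from the infrared end than those of the `(k+1)`-st, and logarithmic asymptotic freedom makes their cubes
# `O((distance)^{−1})` smaller), so the matched discrepancy after `⌊j∕A⌋` blocks is at most the PRODUCT of the block factors, and for a pinned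
# family `astar g m − invSq g m n ≤ (n+m)Wγ · Π_{k<⌊n∕A⌋} M₁γ∕(2(1∕g_IR² + b(m+1+(n−(k+2)A)₊)))` — the factors run over the infrared distances
# `m+1, m+1+(n mod A), m+1+(n mod A)+A, …, m+1+n−2A`, a factorial-type decay in `n∕A` (station S-d4p3-g53-1, fourth file; imports the third)

Cell `pub-balaban`, β-function sub-cell, BINDER row D4 «RemainderConst leaves for Bałaban's split» (`HOME/BINDER-OWNERS.md`; owner lineage
`b2b-balaban-beta-an4`; this file by co-owner #3 lineage `b2b-balaban-beta-d4-p3`, road P3 «the reduction road», generation 53, station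
S-d4p3-g53-1, fourth file; imports the station's third file `RemainderExplicitHistoryDiagonalBoundedMemoryRate`), β-FLOW TEAM duty (1); FREEZE
(0) honoured (def-free module in road P3's own `RemainderExplicit*` series; no leaf, no interface, no Literature file).  SOURCE OF THE SHAPES
ONLY: [Balaban1987RG1] (0.20) p. 256, (0.31) and Thm 2 p. 259, §5 p. 298.  [folklore] real analysis about ONE explicit toy family (ours).
HONEST FRAMING: *"Discharging BetaPertH makes Bałaban's UV stability UNCONDITIONAL — a real constructive-QFT result; it is NOT the continuum
limit and NOT the Clay problem."*  THIS FILE DISCHARGES NOTHING OF THE KIND; nothing of Bałaban's (1.22) is asserted or constructed; row D4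
class UNCHANGED (critical-path width 0; instance 0∕1; D4 DISCHARGE NO DATE); NOT B12 Thm 2, NOT BetaPertH, NOT continuum, NOT Clay.  HONEST
DEPENDENCY: continuum YM on T⁴ ⇐ BetaPertH ∧ nine spine estimates (0/9 proved); BetaPertH ⇐ (D1) ∧ (D4) ∧ CAP+tail; G-an2-4 gates asym, D1
and NE2/3/4.  ABSOLUTE RULE: nothing is cited as a fact.  All letters NOT-IN-PRINT; `BetaFlowAsPrinted S` records a Markov β_n only.

WHY.  The third file bounds every coupling cube below the position of interest by ONE constant `G₃` (the cube at infrared distance `m + 1`)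
and gets the geometric law `θ_m^{⌊n∕A⌋}`.  Along a run the couplings DEcrease towards the ultraviolet (`1∕g_i² ≥ 1∕g_IR² + b·(K − i)`), so the
block `k` positions further from the pin than the target have cubes `≤ γ∕(1∕g_IR² + b·(m+1+(n−(k+1)A)))`; feeding the third file's one-block
contraction `disc_le_firstMoment_mul` with a block-dependent cube bound `G k` (non-decreasing in `k` is not even needed: only `M₁G(k)∕2 ≤ 1` for
each block and `G k ≥` the cubes up to block `k`) gives `d_j ≤ (Π_{k<⌊j∕A⌋} M₁G(k+1)∕2)·max_{[0,A)} d` (§1), and the family read-out (§2) is the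
title's product — each factor at most the third file's `θ_m`, so the hypothesis is still the single inequality `θ_m ≤ 1` (automatic for
`A ≤ 2(m+1)` under `Wγ ≤ b`, third file's `…_far`).  Seat numerics (`HOME/b2b-balaban-beta-d4-p3/g53/numerics/check_file3_rate.py`): for flat
`A = 5`, `W = 0.7`, `γ = √2`, `m = 5` the true `astar − invSq` falls from `2.9·10⁻¹` (n = 0) to `3.1·10⁻¹⁵` (n = 25), i.e. by `≈ 10^{2.8}` per
block, against `θ_m^{−1} = 4.4` per block for the geometric law — the product law is the shape that follows the data.

WHAT IS PROVED ([folklore]; 0 sorry; 0 `def`; profile `ρ ≥ 0` with `ρ(a) = 0` for `a > A`, `A ≥ 1`, `b > 0`; `M₁ = Σ_{a≤A} a·ρ(a)`).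
* §1 TWO PINNED RUNS: **`disc_le_prod_blocks`** (block cube bounds `G k` with `M₁G(k)∕2 ≤ 1`, `d ≤ P` on `[0,A)` ⇒
  `d_j ≤ (Π_{k<⌊j∕A⌋} M₁·G(k+1)∕2)·P` for every `j ≤ j₁`).
* §2 PINNED FAMILY: **`astar_sub_invSq_boundedMemory_prod`** (`θ_m ≤ 1` ⇒ `astar g m − invSq g m n ≤ (Π_{k<⌊n∕A⌋} M₁γ∕(2(1∕g_IR² +
  b(m+1+(n−(k+2)A)₊))))·(n+m)Wγ`; block `k+1`'s factor, ℕ-subtraction), `astar_sub_invSq_boundedMemory_prod_far` (`Wγ ≤ b`, `A ≤ 2(m+1)`: unconditional).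
-/

noncomputable section

open Finset Filter Topology

namespace Summit.QuantumFields.BalabanUV.Beta.RemainderExplicitHistoryDiagonalBoundedMemoryProduct

open Literature.MathematicalPhysics.QuantumFieldTheory.Balaban1983to89
open Literature.MathematicalPhysics.QuantumFieldTheory.Balaban1983to89.FlowStep
open Literature.MathematicalPhysics.QuantumFieldTheory.Balaban1983to89.T4CouplingMatching
open Literature.MathematicalPhysics.QuantumFieldTheory.Balaban1983to89.T4ContinuumCoupling
open Summit.QuantumFields.BalabanUV.Beta.RemainderExplicitHistoryDiagonalMonotone
open Summit.QuantumFields.BalabanUV.Beta.RemainderExplicitHistoryDiagonalWeights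
open Summit.QuantumFields.BalabanUV.Beta.RemainderExplicitHistoryDiagonalTwoRun
open Summit.QuantumFields.BalabanUV.Beta.RemainderExplicitHistoryDiagonalWindow
open Summit.QuantumFields.BalabanUV.Beta.RemainderExplicitHistoryDiagonalBoundedMemoryRate

variable {β : HBeta} {b γ W : ℝ} {ρ : ℕ → ℝ}

/-! ## §1 Two pinned runs: the product over the memory blocks -/

/-- **BLOCK BY BLOCK WITH BLOCK CUBE BOUNDS.**  Profile supported on the ages `≤ A` (`A ≥ 1`, `b > 0`, `ρ ≥ 0`); two runs (A: `K` steps, B: `K + n`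
steps, positive couplings) pinned `g^A_K = g^B_{K+n}`; a position `j₁ ≤ K`; for every block index `k` a bound `G k` of the cubes `(g^A_i)³` of all
`i < j₁` with `⌊i∕A⌋ ≤ k`, each with `M₁·G(k)∕2 ≤ 1`; and `0 ≤ P` bounding `d` on the first window `[0, A)`.  THEN for every `j ≤ j₁`:
`1∕(g^B_{j+n})² − 1∕(g^A_j)² ≤ (Π_{k<⌊j∕A⌋} M₁·G(k+1)∕2)·P` — strong induction on the position; on the window `[j−A, j)` every value obeys the product
up to the previous block (values of the current block carry one more factor `≤ 1`), and the third file's `disc_le_firstMoment_mul` with `G(⌊j∕A⌋)`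
adds the block's factor. [cite: Balaban1987RG1, (0.20) p.256 and Thm 2 p.259] -/
theorem disc_le_prod_blocks
    (hβ : ∀ (k : ℕ) (p : Fin (k + 1) → ℝ),
      β k p = b + ∑ i : Fin (k + 1), ρ (k - i) * min (p (Fin.last k)) (|p (Fin.last k) - p i|))
    (hb : 0 < b) (hρ0 : ∀ a, 0 ≤ ρ a) {A : ℕ} (hA1 : 1 ≤ A) (hρA : ∀ a, A < a → ρ a = 0) {K n : ℕ} {gA gB : ℕ → ℝ}
    (hA : RGEqH K β gA) (hB : RGEqH (K + n) β gB) (hApos : ∀ k, k ≤ K → 0 < gA k) (hBpos : ∀ k, k ≤ K + n → 0 < gB k)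
    (hpin : gA K = gB (K + n)) {j₁ : ℕ} (hj₁ : j₁ ≤ K) {P : ℝ} {G : ℕ → ℝ}
    (hG : ∀ k i, i < j₁ → i / A ≤ k → (gA i) ^ 3 ≤ G k) (hθ1 : ∀ k, (∑ a ∈ range (A + 1), ρ a * a) * (G k / 2) ≤ 1)
    (hθ0 : ∀ k, 0 ≤ (∑ a ∈ range (A + 1), ρ a * a) * (G k / 2)) (hP0 : 0 ≤ P)
    (hP : ∀ i, i < A → i ≤ K → 1 / (gB (i + n)) ^ 2 - 1 / (gA i) ^ 2 ≤ P) :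
    ∀ j, j ≤ j₁ → 1 / (gB (j + n)) ^ 2 - 1 / (gA j) ^ 2
      ≤ (∏ k ∈ range (j / A), (∑ a ∈ range (A + 1), ρ a * a) * (G (k + 1) / 2)) * P := by
  set θ : ℕ → ℝ := fun k => (∑ a ∈ range (A + 1), ρ a * a) * (G k / 2) with hθ
  -- the partial products are non-increasing in the number of blocks and nonnegative
  have hprod0 : ∀ k, 0 ≤ ∏ k' ∈ range k, θ (k' + 1) := fun k => Finset.prod_nonneg fun k' _ => hθ0 _
  have hprod_mono : ∀ k l, k ≤ l → ∏ k' ∈ range l, θ (k' + 1) ≤ ∏ k' ∈ range k, θ (k' + 1) := by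
    intro k l hkl
    induction l with
    | zero => have : k = 0 := by omega
              subst this; exact le_rfl
    | succ l ih =>
      rcases Nat.lt_or_ge k (l + 1) with h | h
      · rw [Finset.prod_range_succ]
        exact (mul_le_of_le_one_right (hprod0 l) (hθ1 _)).trans (ih (by omega))
      · have : k = l + 1 := by omega
        subst this; exact le_rfl
  intro j
  induction j using Nat.strong_induction_on with
  | _ j ih =>
    intro hj
    by_cases hjA : j < A
    · rw [Nat.div_eq_of_lt hjA, Finset.prod_range_zero, one_mul]
      exact hP j hjA (by omega)
    · rw [not_lt] at hjA
      have hq : (j - A) / A + 1 = j / A := (Nat.div_eq_sub_div (by omega) hjA).symm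
      -- the window carries the product up to the previous block
      have hwin : ∀ i, i < j → j ≤ i + A →
          1 / (gB (i + n)) ^ 2 - 1 / (gA i) ^ 2 ≤ (∏ k' ∈ range ((j - A) / A), θ (k' + 1)) * P := by
        intro i hi hiA
        have h1 := ih i hi (by omega)
        have hexp : (j - A) / A ≤ i / A := Nat.div_le_div_right (by omega)
        exact h1.trans (mul_le_mul_of_nonneg_right (hprod_mono _ _ hexp) hP0)
      have hGj : (gA (j - 1)) ^ 3 ≤ G ((j - A) / A + 1) := by
        rw [hq]; exact hG (j / A) (j - 1) (by omega) (Nat.div_le_div_right (by omega))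
      have h := disc_le_firstMoment_mul hβ hb hρ0 hρA hA hB hApos hBpos hpin hjA (by omega) hGj hwin
      rw [← hq, Finset.prod_range_succ]
      calc 1 / (gB (j + n)) ^ 2 - 1 / (gA j) ^ 2
          ≤ (∑ a ∈ range (A + 1), ρ a * a) * (G ((j - A) / A + 1) / 2) * ((∏ k' ∈ range ((j - A) / A), θ (k' + 1)) * P) := h
        _ = (∏ k' ∈ range ((j - A) / A), θ (k' + 1)) * θ ((j - A) / A + 1) * P := by simp only [hθ]; ring

/-! ## §2 Pinned family: the product law in the cutoff -/

/-- **THE PRODUCT LAW OF THE CONTINUUM COUPLING FOR A BOUNDED MEMORY.**  A pinned family of runs of the order-0 profile family (`b > 0`, `γ > 0`,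
`ρ ≥ 0`, `Σ_{a<N} ρ(a) ≤ W`; `g K` the run with `K` steps in ]0,γ], `g K K = g_IR`) whose profile is supported on the ages `≤ A` (`A ≥ 1`), first
moment `M₁ = Σ_{a≤A} a·ρ(a)`.  If `θ_m := M₁γ∕(2(1∕g_IR² + b(m+1))) ≤ 1` THEN for every cutoff `n`:
`astar g m − invSq g m n ≤ (Π_{k<⌊n∕A⌋} M₁γ∕(2(1∕g_IR² + b·(m+1+(n−(k+2)A)₊))))·((n+m)·W·γ)` — the factor of block `k + 1` of the run with
`n + m` steps (positions `< (k+2)A`, all below the position `n`) uses couplings at infrared distance `≥ m+1+(n−(k+2)A)₊`, so each factor is at most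
`θ_m` and the product runs over the distances `m+1, m+1+(n mod A), m+1+(n mod A)+A, …, m+1+n−2A` (written with ℕ-subtraction, `(k+1+1)`). [cite: Balaban1987RG1, (0.20) p.256, (0.31) and Thm 2 p.259] -/
theorem astar_sub_invSq_boundedMemory_prod
    (hβ : ∀ (k : ℕ) (p : Fin (k + 1) → ℝ),
      β k p = b + ∑ i : Fin (k + 1), ρ (k - i) * min (p (Fin.last k)) (|p (Fin.last k) - p i|))
    (hb : 0 < b) (hγ : 0 < γ) (hρ0 : ∀ a, 0 ≤ ρ a) (hρW : ∀ n, ∑ a ∈ range n, ρ a ≤ W) {A : ℕ} (hA1 : 1 ≤ A)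
    (hρA : ∀ a, A < a → ρ a = 0) {g : ℕ → ℕ → ℝ} {gIR : ℝ} (hrun : ∀ K, RGEqH K β (g K))
    (hbox : ∀ K i, i ≤ K → 0 < g K i ∧ g K i ≤ γ) (hpin : ∀ K, g K K = gIR) (m n : ℕ)
    (hθ1 : (∑ a ∈ range (A + 1), ρ a * a) * (γ / (2 * (1 / gIR ^ 2 + b * ((m + 1 : ℕ) : ℝ)))) ≤ 1) :
    astar g m - invSq g m n
      ≤ (∏ k ∈ range (n / A), (∑ a ∈ range (A + 1), ρ a * a)
            * (γ / (2 * (1 / gIR ^ 2 + b * ((m + 1 + (n - (k + 1 + 1) * A) : ℕ) : ℝ)))))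
          * (((n + m : ℕ) : ℝ) * W * γ) := by
  have hcm := continuum_monotone hβ hb hγ hρ0 hρW hrun hbox hpin
  have hlim := hcm.1
  have hdist := hcm.2.1
  have hW : 0 ≤ W := by simpa using hρW 0
  have hgIR : 0 < gIR := by have := (hbox 0 0 le_rfl).1; rwa [hpin] at this
  have hM0 : 0 ≤ ∑ a ∈ range (A + 1), ρ a * a := Finset.sum_nonneg fun a _ => mul_nonneg (hρ0 a) (Nat.cast_nonneg a)
  -- block cube bounds along the run with `n + m` steps
  set G : ℕ → ℝ := fun k => γ / (1 / gIR ^ 2 + b * ((m + 1 + (n - (k + 1) * A) : ℕ) : ℝ)) with hGdef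
  have hDk : ∀ k, 0 < 1 / gIR ^ 2 + b * ((m + 1 + (n - (k + 1) * A) : ℕ) : ℝ) := fun k => by positivity
  have eθ : ∀ k, (∑ a ∈ range (A + 1), ρ a * a) * (γ / (2 * (1 / gIR ^ 2 + b * ((m + 1 + (n - (k + 1 + 1) * A) : ℕ) : ℝ))))
      = (∑ a ∈ range (A + 1), ρ a * a) * (G (k + 1) / 2) := fun k => by rw [hGdef]; field_simp
  -- each block factor is at most `θ_m ≤ 1` and nonnegative
  have hGle : ∀ k, G k ≤ γ / (1 / gIR ^ 2 + b * ((m + 1 : ℕ) : ℝ)) := by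
    intro k
    rw [hGdef]
    refine div_le_div_of_nonneg_left hγ.le (by positivity) ?_
    have : ((m + 1 : ℕ) : ℝ) ≤ ((m + 1 + (n - (k + 1) * A) : ℕ) : ℝ) := by exact_mod_cast Nat.le_add_right _ _
    nlinarith
  have hθ1k : ∀ k, (∑ a ∈ range (A + 1), ρ a * a) * (G k / 2) ≤ 1 := by
    intro k
    refine le_trans ?_ hθ1
    rw [show (∑ a ∈ range (A + 1), ρ a * a) * (γ / (2 * (1 / gIR ^ 2 + b * ((m + 1 : ℕ) : ℝ))))
      = (∑ a ∈ range (A + 1), ρ a * a) * ((γ / (1 / gIR ^ 2 + b * ((m + 1 : ℕ) : ℝ))) / 2) by field_simp]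
    exact mul_le_mul_of_nonneg_left (by linarith [hGle k]) hM0
  have hθ0k : ∀ k, 0 ≤ (∑ a ∈ range (A + 1), ρ a * a) * (G k / 2) := fun k => by
    have : 0 ≤ G k := by rw [hGdef]; positivity
    positivity
  simp_rw [eθ]
  set P : ℝ := ((n + m : ℕ) : ℝ) * W * γ with hPdef
  have hP0 : 0 ≤ P := by rw [hPdef]; positivity
  have hpair : ∀ N, invSq g m (n + N) - invSq g m n
      ≤ (∏ k ∈ range (n / A), (∑ a ∈ range (A + 1), ρ a * a) * (G (k + 1) / 2)) * P := by
    intro N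
    have hA' : RGEqH (n + m) β (g (n + m)) := hrun _
    have hB' : RGEqH (n + m + N) β (g (n + m + N)) := hrun _
    have hpin' : g (n + m) (n + m) = g (n + m + N) (n + m + N) := by rw [hpin, hpin]
    have hApos : ∀ k, k ≤ n + m → 0 < g (n + m) k := fun k hk => (hbox _ k hk).1
    have hBpos : ∀ k, k ≤ n + m + N → 0 < g (n + m + N) k := fun k hk => (hbox _ k hk).1
    -- the cube of a coupling at a position `i < n` with `⌊i∕A⌋ ≤ k` is `≤ G k`
    have hG : ∀ k i, i < n → i / A ≤ k → (g (n + m) i) ^ 3 ≤ G k := by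
      intro k i hi hik
      set x : ℝ := g (n + m) i with hx
      have hxpos : 0 < x := (hbox _ i (by omega)).1
      have hxγ : x ≤ γ := (hbox _ i (by omega)).2
      have hfloor := prof_le_invSq_orderZero hβ hρ0 hrun hbox hpin (n + m - i) i
      have hinv : invSq g (n + m - i) i = 1 / x ^ 2 := by rw [invSq_def, hx, show i + (n + m - i) = n + m by omega]
      rw [hinv] at hfloor
      -- `i < (k+1)·A`, hence the infrared distance `n + m − i ≥ m + 1 + (n − (k+1)A)`
      have hiA : i < (k + 1) * A := by
        have h1 : i / A < k + 1 := by omega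
        exact (Nat.div_lt_iff_lt_mul (by omega)).mp h1
      have hdist' : m + 1 + (n - (k + 1) * A) ≤ n + m - i := by omega
      have hDi : 1 / gIR ^ 2 + b * ((m + 1 + (n - (k + 1) * A) : ℕ) : ℝ) ≤ 1 / gIR ^ 2 + b * ((n + m - i : ℕ) : ℝ) := by
        have : ((m + 1 + (n - (k + 1) * A) : ℕ) : ℝ) ≤ ((n + m - i : ℕ) : ℝ) := by exact_mod_cast hdist'
        nlinarith
      have hx2 : x ^ 2 ≤ 1 / (1 / gIR ^ 2 + b * ((m + 1 + (n - (k + 1) * A) : ℕ) : ℝ)) := by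
        rw [le_div_iff₀ (hDk k)]
        have := mul_le_mul_of_nonneg_left (hDi.trans hfloor) (pow_pos hxpos 2).le
        rwa [mul_one_div, div_self (pow_pos hxpos 2).ne'] at this
      calc x ^ 3 = x * x ^ 2 := by ring
        _ ≤ γ * (1 / (1 / gIR ^ 2 + b * ((m + 1 + (n - (k + 1) * A) : ℕ) : ℝ))) :=
            mul_le_mul hxγ hx2 (pow_pos hxpos 2).le hγ.le
        _ = G k := by rw [hGdef]; field_simp
    have hPall : ∀ i, i < A → i ≤ n + m → 1 / (g (n + m + N) (i + N)) ^ 2 - 1 / (g (n + m) i) ^ 2 ≤ P := by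
      intro i _ hiK
      have e1 : 1 / (g (n + m + N) (i + N)) ^ 2 = invSq g (n + m - i) (i + N) := by
        rw [invSq_def, show i + N + (n + m - i) = n + m + N by omega]
      have e2 : 1 / (g (n + m) i) ^ 2 = invSq g (n + m - i) i := by
        rw [invSq_def, show i + (n + m - i) = n + m by omega]
      rw [e1, e2]
      have hmono := invSq_mono hβ hb hρ0 hrun hbox hpin (n + m - i)
      have h1 : invSq g (n + m - i) (i + N) ≤ astar g (n + m - i) := hmono.ge_of_tendsto (hlim _) _
      have h2 := hdist (n + m - i) i
      rw [abs_le] at h2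
      have h3 : ((n + m - i : ℕ) : ℝ) * W * γ ≤ P := by
        rw [hPdef]
        have : ((n + m - i : ℕ) : ℝ) ≤ ((n + m : ℕ) : ℝ) := by exact_mod_cast (Nat.sub_le _ _)
        have hWγ : 0 ≤ W * γ := mul_nonneg hW hγ.le
        nlinarith
      linarith [h2.1]
    have h := disc_le_prod_blocks hβ hb hρ0 hA1 hρA hA' hB' hApos hBpos hpin' (j₁ := n) (by omega) hG hθ1k hθ0k hP0 hPall
      n le_rfl
    have e1 : invSq g m (n + N) = 1 / (g (n + m + N) (n + N)) ^ 2 := by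
      rw [invSq_def, show n + N + m = n + m + N by omega]
    have e2 : invSq g m n = 1 / (g (n + m) n) ^ 2 := by rw [invSq_def]
    rw [e1, e2]
    exact h
  have h1 : Tendsto (fun N => invSq g m (n + N) - invSq g m n) atTop (𝓝 (astar g m - invSq g m n)) :=
    ((hlim m).comp (tendsto_atTop_atTop_of_monotone (fun a b hab => by omega) fun N => ⟨N, by omega⟩)).sub
      tendsto_const_nhds
  exact le_of_tendsto' h1 hpair

/-- THE SAME WITH NO FURTHER HYPOTHESIS BEYOND HALF THE MEMORY LENGTH (`Wγ ≤ b`, `A ≤ 2(m+1)` ⇒ `θ_m ≤ 1`, third file's computation). [cite: Balaban1987RG1, (0.20) p.256, (0.31) and Thm 2 p.259] -/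
theorem astar_sub_invSq_boundedMemory_prod_far
    (hβ : ∀ (k : ℕ) (p : Fin (k + 1) → ℝ),
      β k p = b + ∑ i : Fin (k + 1), ρ (k - i) * min (p (Fin.last k)) (|p (Fin.last k) - p i|))
    (hb : 0 < b) (hγ : 0 < γ) (hρ0 : ∀ a, 0 ≤ ρ a) (hρW : ∀ n, ∑ a ∈ range n, ρ a ≤ W) (hsmall : W * γ ≤ b) {A : ℕ}
    (hA1 : 1 ≤ A) (hρA : ∀ a, A < a → ρ a = 0) {g : ℕ → ℕ → ℝ} {gIR : ℝ} (hrun : ∀ K, RGEqH K β (g K))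
    (hbox : ∀ K i, i ≤ K → 0 < g K i ∧ g K i ≤ γ) (hpin : ∀ K, g K K = gIR) {m : ℕ} (hmA : A ≤ 2 * (m + 1)) (n : ℕ) :
    astar g m - invSq g m n
      ≤ (∏ k ∈ range (n / A), (∑ a ∈ range (A + 1), ρ a * a)
            * (γ / (2 * (1 / gIR ^ 2 + b * ((m + 1 + (n - (k + 1 + 1) * A) : ℕ) : ℝ)))))
          * (((n + m : ℕ) : ℝ) * W * γ) := by
  refine astar_sub_invSq_boundedMemory_prod hβ hb hγ hρ0 hρW hA1 hρA hrun hbox hpin m n ?_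
  -- the third file's computation of `θ_m ≤ 1`
  have hgIR : 0 < gIR := by have := (hbox 0 0 le_rfl).1; rwa [hpin] at this
  have hW : 0 ≤ W := by simpa using hρW 0
  have hM : ∑ a ∈ range (A + 1), ρ a * a ≤ (A : ℝ) * W := by
    calc ∑ a ∈ range (A + 1), ρ a * a ≤ ∑ a ∈ range (A + 1), ρ a * A :=
          Finset.sum_le_sum fun a ha => mul_le_mul_of_nonneg_left
            (by exact_mod_cast Nat.lt_succ_iff.mp (Finset.mem_range.mp ha)) (hρ0 a)
      _ = (∑ a ∈ range (A + 1), ρ a) * A := by rw [Finset.sum_mul]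
      _ ≤ W * A := mul_le_mul_of_nonneg_right (hρW (A + 1)) (Nat.cast_nonneg A)
      _ = (A : ℝ) * W := by ring
  have hmA' : (A : ℝ) ≤ 2 * ((m + 1 : ℕ) : ℝ) := by exact_mod_cast hmA
  rw [mul_div_assoc', div_le_one (by positivity)]
  have : 0 ≤ 1 / gIR ^ 2 := by positivity
  calc (∑ a ∈ range (A + 1), ρ a * a) * γ ≤ (A : ℝ) * W * γ := by nlinarith
    _ = (A : ℝ) * (W * γ) := by ring
    _ ≤ 2 * ((m + 1 : ℕ) : ℝ) * b := mul_le_mul hmA' hsmall (mul_nonneg hW hγ.le) (by positivity)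
    _ ≤ 2 * (1 / gIR ^ 2 + b * ((m + 1 : ℕ) : ℝ)) := by nlinarith

end Summit.QuantumFields.BalabanUV.Beta.RemainderExplicitHistoryDiagonalBoundedMemoryProduct
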